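import Mathlib.MeasureTheory.Measure.Hausdorff
import Mathlib.Analysis.InnerProductSpace.Basic
import Mathlib.Topology.EMetricSpace.Lipschitz
import Mathlib.MeasureTheory.Integral.Average
import Mathlib.MeasureTheory.Measure.Haar.Basic
import Literature.Analysis.FunctionSpaces.SobolevDomain
import Literature.Analysis.FunctionSpaces.HolderNorm
import HarnessLib

-- provenance: harness21/H21/H21/Prelude/AnalysisL/SobolevTrace.lean @ 0129e27 (interim HEAD d8f2665); M5 mechanical rewrite
/-!
# Lipschitz domains, surface measure, traces, extension, density and embeddings for `W^{k,p}(Ω)`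

Trunk: AnalysisL (outline `H21/Outlines/AnalysisL.md`, Part F, item P7; notion
`sobolev_Wkp_domain`), on top of the accepted `Literature.Prelude.Sobolev.SobolevDomain`
(`MemSobolevDomain`, `eSobolevDomainNorm`, `HasWeakFDerivOn`, `TraceData`) and
`Literature.Prelude.Sobolev.HolderNorm` (`MemBoundedHolder`).

Let `E'` be a finite-dimensional real inner product space with its Borel σ-algebra,
`Ω : Opens E'`, `μ` an additive Haar (Lebesgue) measure on `E'` and `F` a real Banach space.
This file defines

* `Literature.IsLipschitzGraphNear Ω x r`, `Literature.IsLipschitzDomain Ω`: near every boundary point, `Ω` is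
  the (strict) epigraph of a Lipschitz function of `n - 1` variables in a suitable orthonormal
  direction `u` (Grisvard, *Elliptic problems in nonsmooth domains*, Def. 1.2.1.1; Evans, *PDE*,
  App. C.1 with "`C¹`" replaced by "Lipschitz");
* `Literature.IsContDiffGraphNear k Ω x r`, `Literature.IsContDiffDomain k Ω`: the same with a `C^k` graph
  (Evans, *PDE*, App. C.1, "`∂U` is `C^k`");
* `Literature.surfaceMeasure Ω`: the `(n-1)`-dimensional Hausdorff measure restricted to `frontier Ω`
  (Evans–Gariepy, *Measure theory and fine properties of functions*, §2.1 and §3.3.4);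

proves that a `C^k` domain (`k ≥ 1`) is a Lipschitz domain
(`IsContDiffDomain.isLipschitzDomain_holds`), and states as named facts (`def … : Prop`) the
classical theorems on bounded Lipschitz domains: finiteness of
the surface measure (discharged at the end of the file: `isFiniteMeasure_surfaceMeasure_holds`),
the trace theorem (existence of a `TraceData`, Gagliardo 1957) and
uniqueness of the trace, the Calderón–Stein extension theorem, Meyers–Serrin `H = W`, density of
`C^∞(Ω̄)`, Morrey's embedding on the whole space, the Sobolev embedding
`W^{1,p}(Ω) ⊆ L^{p*}(Ω)`, Rellich–Kondrachov on `W^{1,p}(Ω)` and the Poincaré–Wirtinger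
inequality.

## Design notes

* **Mathlib search.** Mathlib (this pin) has `LipschitzWith`, `ContDiff`, Hausdorff measure
  `μH[d]`, `MeasureTheory.average` (`⨍`), and additive Haar measures, but no notion of Lipschitz /
  `C^k` domain, surface measure on a boundary, or Sobolev trace; nothing here duplicates Mathlib.
* **Graphs without projections.** A local graph is described by a unit vector `u` and a function
  `γ : E' → ℝ` defined on all of `E'`; only its values on the hyperplane `uᗮ` matter, since it is
  evaluated at `y - ⟪y, u⟫ u ∈ uᗮ`. This avoids the deprecated `Submodule.orthogonalProjection`
  and the subtype `↥(ℝ ∙ u)ᗮ`. Coordinates are taken relative to the origin of `E'` (not to the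
  centre `x`), which is immaterial since `γ` is arbitrary.
* **Explicit Haar measure.** Following the accepted `poincare_inequality`, every theorem takes an
  explicit `(μ : Measure E') [μ.IsAddHaarMeasure]`; use `volume` at call sites.
* `surfaceMeasure Ω` is already restricted to `frontier Ω`; `TraceData F Ω p μ σ` restricts `σ`
  to `frontier Ω` once more, which is idempotent (`Measure.restrict_restrict` with equal sets).

## References

* E. Gagliardo, *Caratterizzazioni delle tracce sulla frontiera ...*, Rend. Sem. Mat. Univ.
  Padova 27 (1957).
* A. P. Calderón, *Lebesgue spaces of differentiable functions and distributions*, Proc. Sympos.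
  Pure Math. 4 (1961).
* E. M. Stein, *Singular integrals and differentiability properties of functions* (1970), Ch. VI.
* N. Meyers, J. Serrin, *H = W*, Proc. Nat. Acad. Sci. USA 51 (1964).
* L. C. Evans, *Partial Differential Equations*, 2nd ed. (2010), Ch. 5 and App. C.
* L. C. Evans, R. F. Gariepy, *Measure Theory and Fine Properties of Functions*, CRC Press
  (1992), §2.2 Theorem 2, §2.4.1 Theorem 1, §3.3.4, §4.2 (revised ed. 2015: Theorems 2.5,
  2.8, §3.3.4 B, Definition 4.4).
* R. Adams, J. Fournier, *Sobolev Spaces*, 2nd ed. (2003), Ch. 4–6.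
* P. Grisvard, *Elliptic problems in nonsmooth domains* (1985), §1.2.
-/

noncomputable section

open MeasureTheory TopologicalSpace Filter ENNReal Bornology
open scoped ContDiff Topology NNReal InnerProductSpace

namespace Literature.Analysis.FunctionSpaces

variable {E' : Type*} [NormedAddCommGroup E'] [InnerProductSpace ℝ E']
  [MeasurableSpace E'] [BorelSpace E']

/-! ### Lipschitz and `C^k` domains

The definitions in this section make sense on any real inner product space; finite
dimensionality is assumed only from the theorems onwards. -/

/-- `IsLipschitzGraphNear Ω x r`: inside the ball `B(x, r)`, the open set `Ω` is the strict
epigraph of a Lipschitz function in some orthonormal direction `u`: there are a unit vector `u`,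
a Lipschitz `γ : E' → ℝ` (only its values on `uᗮ` matter) with
`Ω ∩ B(x,r) = {y ∈ B(x,r) | γ (y - ⟪y,u⟫ u) < ⟪y,u⟫}` (Grisvard, *Elliptic problems in nonsmooth
domains*, Def. 1.2.1.1; Evans, *PDE*, App. C.1 with `γ` Lipschitz). [folklore] -/
def IsLipschitzGraphNear (Ω : Opens E') (x : E') (r : ℝ) : Prop :=
  ∃ (u : E') (_ : ‖u‖ = 1) (γ : E' → ℝ) (K : ℝ≥0), LipschitzWith K γ ∧
    (Ω : Set E') ∩ Metric.ball x r =
      {y | y ∈ Metric.ball x r ∧ γ (y - ⟪y, u⟫_ℝ • u) < ⟪y, u⟫_ℝ}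

/-- `IsLipschitzDomain Ω`: the open set `Ω` has Lipschitz boundary, i.e. every boundary point has
a ball in which `Ω` is the strict epigraph of a Lipschitz function in some orthonormal direction
(Grisvard, *Elliptic problems in nonsmooth domains*, Def. 1.2.1.1; Evans, *PDE*, App. C.1;
Adams–Fournier, *Sobolev Spaces*, §4.9 "strong local Lipschitz condition", equivalent for
bounded `Ω`). [folklore] -/
def IsLipschitzDomain (Ω : Opens E') : Prop :=
  ∀ x ∈ frontier (Ω : Set E'), ∃ r > (0 : ℝ), IsLipschitzGraphNear Ω x r

/-- `IsContDiffGraphNear k Ω x r`: inside the ball `B(x, r)`, `Ω` is the strict epigraph of a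
`C^k` function in some orthonormal direction `u`:
`Ω ∩ B(x,r) = {y ∈ B(x,r) | γ (y - ⟪y,u⟫ u) < ⟪y,u⟫}` with `γ : E' → ℝ` of class `C^k`
(Evans, *PDE*, App. C.1, Definition "`∂U` is `C^k`"). [folklore] -/
def IsContDiffGraphNear (k : ℕ∞) (Ω : Opens E') (x : E') (r : ℝ) : Prop :=
  ∃ (u : E') (_ : ‖u‖ = 1) (γ : E' → ℝ), ContDiff ℝ k γ ∧
    (Ω : Set E') ∩ Metric.ball x r =
      {y | y ∈ Metric.ball x r ∧ γ (y - ⟪y, u⟫_ℝ • u) < ⟪y, u⟫_ℝ}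

/-- `IsContDiffDomain k Ω`: the open set `Ω` has `C^k` boundary, i.e. every boundary point has
a ball in which `Ω` is the strict epigraph of a `C^k` function in some orthonormal direction
(Evans, *PDE*, App. C.1, Definition "`∂U` is `C^k`"). [folklore] -/
def IsContDiffDomain (k : ℕ∞) (Ω : Opens E') : Prop :=
  ∀ x ∈ frontier (Ω : Set E'), ∃ r > (0 : ℝ), IsContDiffGraphNear k Ω x r

/-- A bounded `C^k` domain, `k ≥ 1`, is a Lipschitz domain: a `C¹` graph function is Lipschitz on
a neighbourhood of the (compact) relevant region, and `γ` may be modified away from it to a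
globally Lipschitz function (Grisvard, *Elliptic problems in nonsmooth domains*, §1.2.1;
Evans, *PDE*, App. C.1). [cite: Grisvard1985, §1.2.1] -/
def IsContDiffDomain.isLipschitzDomain : Prop :=
  ∀ {k : ℕ∞} {Ω : Opens E'} (hΩ : IsContDiffDomain k Ω) (hk : 1 ≤ k) (hb : IsBounded (Ω : Set E')),
    IsLipschitzDomain Ω

omit [MeasurableSpace E'] [BorelSpace E'] in
/-- A `C^k` graph near `x` with `k ≥ 1` is a Lipschitz graph near `x` in a possibly smaller ball:
`γ` is `C¹`, hence Lipschitz on a neighbourhood `t` of `P x`, `P y = y - ⟪y, u⟫ u`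
(`ContDiffAt.exists_lipschitzOnWith`); a McShane extension of `γ|ₜ`
(`LipschitzOnWith.extend_real`) is globally Lipschitz and describes `Ω` in every ball `B(x, r')`,
`r' ≤ r`, that `P` maps into `t` (Grisvard, *Elliptic problems in nonsmooth domains*, §1.2.1,
remark after Def. 1.2.1.2; Evans, *PDE*, App. C.1). [cite: Grisvard1985, §1.2.1] -/
theorem IsContDiffGraphNear.exists_isLipschitzGraphNear {k : ℕ∞} {Ω : Opens E'} {x : E'}
    {r : ℝ} (h : IsContDiffGraphNear k Ω x r) (hk : 1 ≤ k) (hr : 0 < r) :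
    ∃ r' > (0 : ℝ), IsLipschitzGraphNear Ω x r' := by
  obtain ⟨u, hu, γ, hγ, hΩ⟩ := h
  -- the "projection" `P y = y - ⟪y, u⟫ u` onto `uᗮ`
  set P : E' → E' := fun y => y - ⟪y, u⟫_ℝ • u with hP
  have hPc : Continuous P :=
    continuous_id.sub ((continuous_id.inner continuous_const).smul continuous_const)
  -- `γ` is Lipschitz on a neighbourhood `t` of `P x`; extend `γ|ₜ` to a globally Lipschitz `g`
  obtain ⟨K, t, ht, hγt⟩ :=
    ((hγ.of_le (by exact_mod_cast hk)).contDiffAt (x := P x)).exists_lipschitzOnWith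
  obtain ⟨g, hg, hγg⟩ := hγt.extend_real
  -- shrink the ball so that `P` maps it into `t`
  obtain ⟨ε, hε, hεt⟩ := Metric.mem_nhds_iff.1 (hPc.continuousAt.preimage_mem_nhds ht)
  refine ⟨min r ε, lt_min hr hε, u, hu, g, K, hg, ?_⟩
  ext y
  have key : y ∈ Metric.ball x (min r ε) → (γ (P y) < ⟪y, u⟫_ℝ ↔ g (P y) < ⟪y, u⟫_ℝ) :=
    fun hy => by rw [hγg (hεt (Metric.ball_subset_ball (min_le_right _ _) hy))]
  constructor
  · rintro ⟨hyΩ, hy⟩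
    have hy' : y ∈ (Ω : Set E') ∩ Metric.ball x r :=
      ⟨hyΩ, Metric.ball_subset_ball (min_le_left _ _) hy⟩
    rw [hΩ] at hy'
    exact ⟨hy, (key hy).1 hy'.2⟩
  · rintro ⟨hy, hyg⟩
    have hy' : y ∈ (Ω : Set E') ∩ Metric.ball x r := by
      rw [hΩ]
      exact ⟨Metric.ball_subset_ball (min_le_left _ _) hy, (key hy).2 hyg⟩
    exact ⟨hy'.1, hy⟩

omit [MeasurableSpace E'] [BorelSpace E'] in
/-- **Discharge** of `IsContDiffDomain.isLipschitzDomain`: a `C^k` domain, `k ≥ 1`, is a Lipschitz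
domain (pointwise from `IsContDiffGraphNear.exists_isLipschitzGraphNear`; the boundedness
hypothesis of the fact is not needed) (Grisvard, *Elliptic problems in nonsmooth domains*,
§1.2.1; Evans, *PDE*, App. C.1). [cite: Grisvard1985, §1.2.1] -/
theorem IsContDiffDomain.isLipschitzDomain_holds :
    (IsContDiffDomain.isLipschitzDomain (E' := E')) := by
  intro k Ω hΩ hk _ x hx
  obtain ⟨r, hr, h⟩ := hΩ x hx
  exact h.exists_isLipschitzGraphNear hk hr

/-! ### Surface measure -/

/-- The surface measure of `∂Ω`: the `(n-1)`-dimensional Hausdorff measure `μH[n-1]` on `E'`,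
`n = finrank ℝ E'`, restricted to `frontier Ω` (Evans–Gariepy, *Measure theory and fine
properties of functions*, §2.1 and §3.3.4: for Lipschitz boundaries `μH[n-1]⌊∂Ω` is the classical
surface measure). Intended for `finrank ℝ E' ≥ 1`; the natural-number subtraction is harmless
since for `finrank ℝ E' = 0` every open set has empty frontier and the measure is `0`. The
restriction to `frontier Ω` is idempotent with the further restriction performed inside
`TraceData F Ω p μ σ`; it is kept here so that `isFiniteMeasure_surfaceMeasure` is
meaningful. [folklore] -/
def surfaceMeasure (Ω : Opens E') : Measure E' :=
  μH[((Module.finrank ℝ E' - 1 : ℕ) : ℝ)].restrict (frontier (Ω : Set E'))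

/-- Unfolding `surfaceMeasure`. [folklore] -/
theorem surfaceMeasure_def (Ω : Opens E') :
    surfaceMeasure Ω =
      μH[((Module.finrank ℝ E' - 1 : ℕ) : ℝ)].restrict (frontier (Ω : Set E')) := rfl

/-- Restricting the surface measure to the boundary once more changes nothing (idempotence of
`Measure.restrict`; this is the restriction performed inside `TraceData`). [folklore] -/
@[simp]
theorem surfaceMeasure_restrict_frontier (Ω : Opens E') :
    (surfaceMeasure Ω).restrict (frontier (Ω : Set E')) = surfaceMeasure Ω := by
  rw [surfaceMeasure, Measure.restrict_restrict isClosed_frontier.measurableSet,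
    Set.inter_self]

variable [FiniteDimensional ℝ E']

-- Binder repair (2026-08-16): the header instance deliberately shadows the section's, which a
-- `def` does not capture (it ranged too widely before); the overlapping-instances linter is moot.
set_option linter.overlappingInstances false in
/-- The boundary of a bounded Lipschitz domain has finite `(n-1)`-dimensional Hausdorff measure
(Evans–Gariepy, *Measure theory and fine properties of functions*, §3.3.4 (area formula for
Lipschitz graphs) together with compactness of `∂Ω`). [cite: EvansGariepy1992, §3.3.4 (area formula for Lipschitz graphs)]
(Binder repair 2026-08-16: `[FiniteDimensional ℝ E']` is written in the header so that it is a
parameter of the elaborated constant; as a section instance unused by the body it was silently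
dropped, so the fact ranged over cases the printed theorem excludes.) -/
def isFiniteMeasure_surfaceMeasure [FiniteDimensional ℝ E'] : Prop :=
  ∀ {Ω : Opens E'} (hΩ : IsLipschitzDomain Ω) (hb : IsBounded (Ω : Set E')),
    IsFiniteMeasure (surfaceMeasure Ω)

/-! ### Traces, extension, density, embeddings -/

variable {F : Type*} [NormedAddCommGroup F] [NormedSpace ℝ F] [CompleteSpace F]

variable (F) in
-- Binder repair (2026-08-16): the header instance deliberately shadows the section's, which a
-- `def` does not capture (it ranged too widely before); the overlapping-instances linter is moot.
set_option linter.overlappingInstances false in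
/-- **Trace theorem** (Gagliardo, Rend. Sem. Mat. Univ. Padova 27 (1957); Evans, *PDE*, §5.5,
Theorems 1–2 for `C¹` boundaries; Grisvard, Thm. 1.5.1.3 for Lipschitz): on a bounded Lipschitz
domain and for `1 ≤ p < ∞` there is a bounded linear trace operator
`T : W^{1,p}(Ω) → L^p(∂Ω, μH[n-1])` restricting smooth functions to the boundary and with kernel
`W₀^{1,p}(Ω)`, i.e. the hypothesis structure `TraceData F Ω p μ (surfaceMeasure Ω)` is
inhabited. [cite: Grisvard1985, Thm. 1.5.1.3] [cite: Evans2010, §5.5 Theorems 1–2 (C¹ boundaries)]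
(Binder repair 2026-08-16: `[CompleteSpace F]` is written in the header so that it is a parameter
of the elaborated constant; as a section instance unused by the body it was silently dropped, so
the fact ranged over cases the printed theorem excludes.) -/
def trace_theorem [CompleteSpace F] : Prop :=
  ∀ {Ω : Opens E'} (hΩ : IsLipschitzDomain Ω) (hb : IsBounded (Ω : Set E')) (p : ℝ≥0∞) (hp : 1 ≤ p) (hp' : p ≠ ⊤) (μ : Measure E') [μ.IsAddHaarMeasure],
    Nonempty (TraceData F Ω p μ (surfaceMeasure Ω))

/-- **Uniqueness of the trace** (Evans, *PDE*, §5.5, Theorem 1 and §5.3.3, Theorem 3): on a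
bounded Lipschitz domain with `1 ≤ p < ∞`, functions smooth up to the boundary are dense in
`W^{1,p}(Ω)`, so any two trace operators (bounded, linear, restricting smooth functions) agree
`μH[n-1]`-a.e. on `∂Ω` on every `f ∈ W^{1,p}(Ω)`. [cite: Evans2010, §5.5 Theorem 1 with §5.3.3 Theorem 3] -/
def traceData_ae_eq : Prop :=
  ∀ {Ω : Opens E'} (hΩ : IsLipschitzDomain Ω) (hb : IsBounded (Ω : Set E')) {p : ℝ≥0∞} (hp : 1 ≤ p) (hp' : p ≠ ⊤) {μ : Measure E'} [μ.IsAddHaarMeasure] (T T' : TraceData F Ω p μ (surfaceMeasure Ω)) {f : E' → F} (hf : MemSobolevDomain 1 p Ω μ f),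
    T.trace f =ᵐ[surfaceMeasure Ω] T'.trace f

/-- **Calderón–Stein extension theorem** (Calderón, Proc. Sympos. Pure Math. 4 (1961), for
`1 < p < ∞`; Stein, *Singular integrals* (1970), Ch. VI, §3, Theorem 5, for all `k` and
`1 ≤ p ≤ ∞` simultaneously): on a bounded Lipschitz domain there is a linear extension operator
`ext` with `ext f = f` on `Ω` and `‖ext f‖_{W^{k,p}(E')} ≤ C ‖f‖_{W^{k,p}(Ω)}` for all
`f ∈ W^{k,p}(Ω)`. (Values of `ext` on non-`W^{k,p}` inputs are irrelevant.) [cite: SteinSingularIntegrals1970, Ch. VI §3 Theorem 5] -/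
def stein_extension : Prop :=
  ∀ {Ω : Opens E'} (hΩ : IsLipschitzDomain Ω) (hb : IsBounded (Ω : Set E')) (k : ℕ) (p : ℝ≥0∞) (hp : 1 ≤ p) (μ : Measure E') [μ.IsAddHaarMeasure],
    ∃ (ext : (E' → F) → (E' → F)) (C : ℝ≥0),
      (∀ f g, ext (f + g) = ext f + ext g) ∧ (∀ (c : ℝ) (f : E' → F), ext (c • f) = c • ext f) ∧
      ∀ f, MemSobolevDomain k p Ω μ f →
        Set.EqOn (ext f) f Ω ∧ MemSobolevDomain k p ⊤ μ (ext f) ∧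
          eSobolevDomainNorm k p ⊤ μ (ext f) ≤ C * eSobolevDomainNorm k p Ω μ f

/-- **Meyers–Serrin theorem `H = W`** (Meyers–Serrin, Proc. Nat. Acad. Sci. USA 51 (1964);
Evans, *PDE*, §5.3.2, Theorem 2; Adams–Fournier, Thm. 3.17): on an *arbitrary* open set `Ω` and
for `1 ≤ p < ∞`, functions smooth in `Ω` are dense in `W^{k,p}(Ω)`: every `f ∈ W^{k,p}(Ω)` is
the `W^{k,p}(Ω)`-limit of functions `φₙ` with `φₙ ∈ C^∞(Ω)`. [cite: MeyersSerrin1964, Theorem] [cite: Evans2010, §5.3.2 Theorem 2] [cite: AdamsFournier2003, Thm. 3.17] -/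
def meyers_serrin : Prop :=
  ∀ (Ω : Opens E') {k : ℕ} {p : ℝ≥0∞} (hp : 1 ≤ p) (hp' : p ≠ ⊤) (μ : Measure E') [μ.IsAddHaarMeasure] {f : E' → F} (hf : MemSobolevDomain k p Ω μ f),
    ∃ φ : ℕ → E' → F, (∀ n, ContDiffOn ℝ ∞ (φ n) (Ω : Set E')) ∧
      Tendsto (fun n => eSobolevDomainNorm k p Ω μ (f - φ n)) atTop (𝓝 0)

/-- **Density of `C^∞(Ω̄)`** (Evans, *PDE*, §5.3.3, Theorem 3, stated there for `C¹`
boundaries; Adams–Fournier, Thm. 3.22 for the segment condition, satisfied by Lipschitz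
domains): on a bounded Lipschitz domain and for `1 ≤ p < ∞`, restrictions to `Ω` of smooth
functions on `E'` are dense in `W^{k,p}(Ω)`. [cite: AdamsFournier2003, Thm. 3.22] [cite: Evans2010, §5.3.3 Theorem 3 (C¹ boundaries)] -/
def smooth_upToBoundary_dense : Prop :=
  ∀ {Ω : Opens E'} (hΩ : IsLipschitzDomain Ω) (hb : IsBounded (Ω : Set E')) {k : ℕ} {p : ℝ≥0∞} (hp : 1 ≤ p) (hp' : p ≠ ⊤) (μ : Measure E') [μ.IsAddHaarMeasure] {f : E' → F} (hf : MemSobolevDomain k p Ω μ f),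
    ∃ φ : ℕ → E' → F, (∀ n, ContDiff ℝ ∞ (φ n)) ∧
      Tendsto (fun n => eSobolevDomainNorm k p Ω μ (f - φ n)) atTop (𝓝 0)

/-- **Morrey's embedding** on the whole space (Evans, *PDE*, §5.6.2, Theorems 4–5): for
`n = finrank ℝ E' < p < ∞`, every `f ∈ W^{1,p}(E')` has a representative `g = f` a.e. which is
bounded and Hölder continuous of exponent `1 - n/p`, i.e. `g ∈ C^{0,1-n/p}_b(E')`
(`MemBoundedHolder`). [cite: Evans2010, §5.6.2 Theorems 4–5] -/
def morrey_embedding : Prop :=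
  ∀ {p : ℝ≥0∞} (hp : (Module.finrank ℝ E' : ℝ) < p.toReal) (hp' : p ≠ ⊤) (μ : Measure E') [μ.IsAddHaarMeasure] {f : E' → F} (hf : MemSobolevDomain 1 p ⊤ μ f),
    ∃ g : E' → F, g =ᵐ[μ] f ∧
      MemBoundedHolder (Real.toNNReal (1 - Module.finrank ℝ E' / p.toReal)) g

/-- **Sobolev embedding on a bounded Lipschitz domain** (Adams–Fournier, *Sobolev Spaces*,
Thm. 4.12, Part I, Case C with `k = 1`; Evans, *PDE*, §5.6.1, Theorem 2 for `C¹` boundaries):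
for `1 ≤ p < n = finrank ℝ E'` and `p* = np/(n-p)`, `W^{1,p}(Ω) ⊆ L^{p*}(Ω)`. [cite: AdamsFournier2003, Thm. 4.12 Part I Case C (k = 1)] [cite: Evans2010, §5.6.1 Theorem 2 (C¹ boundaries)] -/
def sobolev_embedding_domain : Prop :=
  ∀ {Ω : Opens E'} (hΩ : IsLipschitzDomain Ω) (hb : IsBounded (Ω : Set E')) {p : ℝ} (hp : 1 ≤ p) (hpd : p < Module.finrank ℝ E') (μ : Measure E') [μ.IsAddHaarMeasure] {f : E' → F} (hf : MemSobolevDomain 1 (ENNReal.ofReal p) Ω μ f),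
    MemLp f (ENNReal.ofReal (Module.finrank ℝ E' * p / (Module.finrank ℝ E' - p)))
      (μ.restrict Ω)

/-- **Sobolev embedding on a bounded Lipschitz domain — corrected statement** of
`sobolev_embedding_domain` (same theorem and citation: Adams–Fournier, *Sobolev Spaces*, 2nd ed.
(2003), Thm. 4.12, Part I, Case C with `k = 1`; Adams (1975), Thm. 5.4 / Lemma 5.10; Evans,
*PDE*, §5.6.1, Theorem 2 for `C¹` boundaries): for `1 ≤ p < n = finrank ℝ E'`, `p* = np/(n-p)`,
`W^{1,p}(Ω) ⊆ L^{p*}(Ω)`, **with the hypotheses `[BorelSpace E']` and `[CompleteSpace F]` recorded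
inside the proposition**. Discrepancy: `sobolev_embedding_domain` is a `def`, and a `def` only
takes as parameters the section instances its body uses, so the section's `[BorelSpace E']`,
`[FiniteDimensional ℝ E']` and `[CompleteSpace F]` are *not* part of that proposition (finite
dimension is implied by `p < finrank ℝ E'`, the other two are not). For a non-complete `F` every
Bochner integral vanishes (`MeasureTheory.integral_of_not_completeSpace`), `HasWeakFDerivOn` is
vacuous, `W^{1,p}(Ω; F) = L^p(Ω; F)` and the inclusion in `L^{p*}(Ω)` fails; so
`sobolev_embedding_domain` is provable only in contexts carrying these instances
(`Literature.Analysis.FunctionSpaces.sobolev_embedding_domain_holds`, `Literature.Analysis.FunctionSpaces.SobolevTraceEmbeddingProofs`),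
whereas the present statement is proved outright there (`Literature.Analysis.FunctionSpaces.memLp_of_memSobolevDomain_one`).
[cite: AdamsFournier2003, Thm. 4.12 Part I Case C (k = 1)] [cite: Adams1975, Lemma 5.10] -/
def sobolev_embedding_domain' : Prop :=
  ∀ [BorelSpace E'] [CompleteSpace F] {Ω : Opens E'} (hΩ : IsLipschitzDomain Ω)
    (hb : IsBounded (Ω : Set E')) {p : ℝ} (hp : 1 ≤ p) (hpd : p < Module.finrank ℝ E')
    (μ : Measure E') [μ.IsAddHaarMeasure] {f : E' → F}
    (hf : MemSobolevDomain 1 (ENNReal.ofReal p) Ω μ f),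
    MemLp f (ENNReal.ofReal (Module.finrank ℝ E' * p / (Module.finrank ℝ E' - p)))
      (μ.restrict Ω)

/-- **Rellich–Kondrachov compactness theorem** on `W^{1,p}(Ω)` of a bounded Lipschitz domain,
sequential form (Adams–Fournier, *Sobolev Spaces*, Thm. 6.3, Parts I–III with `j = 0`, `k = 1`,
`q = p`; Evans, *PDE*, §5.7, Theorem 1 for `C¹` boundaries): with finite-dimensional range and
`1 ≤ p ≤ ∞`, every sequence bounded in `W^{1,p}(Ω)` has a subsequence converging in `L^p(Ω)`.
(The cited statements cover `1 ≤ p < ∞`; for `p = ∞` on a bounded Lipschitz domain `W^{1,∞}(Ω)`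
consists of Lipschitz functions and the claim is Arzelà–Ascoli, so the full range is stated,
mirroring the accepted `rellich_kondrachov` for `W₀^{1,p}`.) [cite: AdamsFournier2003, Thm. 6.3 (1 ≤ p < ∞; p = ∞ see docstring)] [cite: Evans2010, §5.7 Theorem 1 (C¹ boundaries)] -/
def rellich_kondrachov_domain : Prop :=
  ∀ [FiniteDimensional ℝ F] {Ω : Opens E'} (hΩ : IsLipschitzDomain Ω) (hb : IsBounded (Ω : Set E')) (p : ℝ≥0∞) (hp : 1 ≤ p) (μ : Measure E') [μ.IsAddHaarMeasure] (u : ℕ → E' → F) (hu : ∀ n, MemSobolevDomain 1 p Ω μ (u n)) (M : ℝ≥0) (hM : ∀ n, eSobolevDomainNorm 1 p Ω μ (u n) ≤ M),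
    ∃ (f : E' → F) (ψ : ℕ → ℕ), StrictMono ψ ∧ MemLp f p (μ.restrict Ω) ∧
      Tendsto (fun n => eLpNorm (u (ψ n) - f) p (μ.restrict Ω)) atTop (𝓝 0)

/-- **Rellich–Kondrachov compactness theorem on `W^{1,p}(Ω)` of a bounded Lipschitz domain —
corrected statement** of `rellich_kondrachov_domain` (same theorem and citations: Adams–Fournier,
*Sobolev Spaces*, 2nd ed. (2003), Thm. 6.3 = Adams (1975), Thm. 6.2 "The Rellich–Kondrachov
theorem", p. 144, Parts I–II with `j = 0`, `m = 1`, `q = p`, `Ω₀ = Ω` bounded: for a domain with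
the cone property — bounded Lipschitz domains have it — and `1 ≤ p < ∞` the imbedding
`W^{1,p}(Ω) → L^p(Ω)` is compact; Evans, *PDE*, §5.7, Theorem 1 for `C¹` boundaries), sequential
form: with finite-dimensional range and `1 ≤ p ≤ ∞`, every sequence bounded in `W^{1,p}(Ω)` has a
subsequence converging in `L^p(Ω)`, **with the hypothesis `[BorelSpace E']` recorded inside the
proposition** (as in `rellich_kondrachov` of `SobolevDomain`). Discrepancy:
`rellich_kondrachov_domain` is a `def`, and a `def` only takes as parameters the section
instances its body uses — here `[MeasurableSpace E']` and `[FiniteDimensional ℝ E']` (through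
`eSobolevDomainNorm`) but *not* the section's `[BorelSpace E']`
(`#check @rellich_kondrachov_domain`). Without it the proposition quantifies over every σ-algebra
on `E'` carrying an additive Haar measure in Mathlib's sense, and then it fails: on `ℝⁿ` with the
σ-algebra of `ℤⁿ`-periodic Borel sets, `μ A = λ(A ∩ [0,1)ⁿ)` is a translation-invariant
probability measure, finite on compacts and positive on opens (outer measure), whose null sets
are the Lebesgue-null sets; for a ball `Ω` containing a period cell `μ.restrict Ω = μ`,
a.e.-strongly measurable functions are a.e. equal to periodic ones, so for a test function `φ`
on `Ω` the integrand `(∂ᵥφ) • u` of `HasWeakFDerivOn` is integrable only if it vanishes a.e.,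
both Bochner integrals of the defining identity are `0`, `g = 0` is a weak derivative of every
periodic `u ∈ L^p(μ)`, and `uₖ(x) = sin (2πk x₁)` is bounded in this "`W^{1,p}(Ω)`" with
`‖uₖ - uₗ‖_{L^p(Ω)} ≥ 1/2` for `k ≠ l`. So `rellich_kondrachov_domain` is provable only in
contexts carrying `[BorelSpace E']` — the setting of the sources, Lebesgue measure on `ℝⁿ` —
(`Literature.Analysis.FunctionSpaces.rellich_kondrachov_domain_holds`, `Literature.Analysis.FunctionSpaces.SobolevTraceRellichProofs`),
whereas the present statement is proved outright there (`Literature.rellich_kondrachov_domain'_holds`).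
`[CompleteSpace F]` follows from `[FiniteDimensional ℝ F]` and is not recorded. Beyond print:
codomain any finite-dimensional `F` (Adams: scalar functions), any additive Haar measure `μ`,
and `p = ∞` (the cited statements cover `1 ≤ p < ∞`; for `p = ∞` the claim is Arzelà–Ascoli,
see `rellich_kondrachov_domain`). [cite: AdamsFournier2003, Thm. 6.3 (1 ≤ p < ∞; p = ∞ see docstring)] [cite: Adams1975, Thm. 6.2 p. 144 (Parts I–II, j = 0, m = 1, q = p, Ω₀ = Ω bounded)] [cite: Evans2010, §5.7 Theorem 1 (C¹ boundaries)] -/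
def rellich_kondrachov_domain' : Prop :=
  ∀ [BorelSpace E'] [FiniteDimensional ℝ F] {Ω : Opens E'} (hΩ : IsLipschitzDomain Ω)
    (hb : IsBounded (Ω : Set E')) (p : ℝ≥0∞) (hp : 1 ≤ p) (μ : Measure E') [μ.IsAddHaarMeasure]
    (u : ℕ → E' → F) (hu : ∀ n, MemSobolevDomain 1 p Ω μ (u n)) (M : ℝ≥0)
    (hM : ∀ n, eSobolevDomainNorm 1 p Ω μ (u n) ≤ M),
    ∃ (f : E' → F) (ψ : ℕ → ℕ), StrictMono ψ ∧ MemLp f p (μ.restrict Ω) ∧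
      Tendsto (fun n => eLpNorm (u (ψ n) - f) p (μ.restrict Ω)) atTop (𝓝 0)

/-- **Poincaré–Wirtinger inequality** (Evans, *PDE*, §5.8.1, Theorem 1, stated there for `C¹`
boundaries; the proof only uses Rellich–Kondrachov, valid on Lipschitz domains): on a bounded
connected Lipschitz domain and for `1 ≤ p ≤ ∞` there is `C` with
`‖f - ⨍_Ω f‖_{L^p(Ω)} ≤ C ‖Df‖_{L^p(Ω)}` for every `f ∈ W^{1,p}(Ω)` with weak derivative `Df = g`
(operator norm of `g x`). The average `⨍ y in Ω, f y ∂μ` is Mathlib's `MeasureTheory.average`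
(a Bochner integral, well defined since `f ∈ L^p(Ω) ⊆ L¹(Ω)` on bounded `Ω`). [cite: Evans2010, §5.8.1 Theorem 1 (stated for C¹ boundaries; Lipschitz via Rellich–Kondrachov, see docstring)] -/
def poincare_wirtinger : Prop :=
  ∀ {Ω : Opens E'} (hΩ : IsLipschitzDomain Ω) (hb : IsBounded (Ω : Set E')) (hc : IsConnected (Ω : Set E')) (p : ℝ≥0∞) (hp : 1 ≤ p) (μ : Measure E') [μ.IsAddHaarMeasure],
    ∃ C : ℝ≥0, ∀ (f : E' → F) (g : E' → E' →L[ℝ] F), MemSobolevDomain 1 p Ω μ f →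
      HasWeakFDerivOn Ω μ f g →
      eLpNorm (fun x => f x - ⨍ y in (Ω : Set E'), f y ∂μ) p (μ.restrict Ω) ≤
        C * eLpNorm g p (μ.restrict Ω)

/-! ### Finiteness of the surface measure (discharge of `isFiniteMeasure_surfaceMeasure`)

Standard argument (Evans–Gariepy, *Measure theory and fine properties of functions*, §2.4.1,
Theorem 1: `𝓗^s(f(A)) ≤ Lip(f)^s 𝓗^s(A)`; §2.2, Theorem 2: `𝓗^n = 𝓛^n` on `ℝ^n`; §4.2, Lipschitz
boundaries): `∂Ω` is compact, and near each boundary point `∂Ω` lies on the graph of the Lipschitz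
function `γ` over the hyperplane `uᗮ ≃L ℝ^{n-1}`, i.e. inside the image of a compact subset of
`ℝ^{n-1}` under a Lipschitz map, which has finite `μH[n-1]`-measure. Only Mathlib's
`LipschitzWith.hausdorffMeasure_image_le`, `MeasureTheory.hausdorffMeasure_pi_real` and
`IsCompact.measure_lt_top_of_nhdsWithin` are used. -/

omit [MeasurableSpace E'] [BorelSpace E'] [FiniteDimensional ℝ E'] in
/-- Inside a ball `B(x, r)` in which the open set `Ω` is the strict epigraph
`{y | γ (y - ⟪y, u⟫ u) < ⟪y, u⟫}` of a continuous `γ`, every boundary point of `Ω` lies on the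
graph `{y | γ (y - ⟪y, u⟫ u) = ⟪y, u⟫}`: "`<`" would put `y` in `Ω`, which is disjoint from its
frontier since `Ω` is open, and "`>`" holds on an open neighbourhood of `y` in `B(x, r)` disjoint
from `Ω`, contradicting `y ∈ closure Ω` (Evans–Gariepy, *Measure theory and fine properties of
functions*, §4.2, Lipschitz boundaries; revised ed. Definition 4.4). [folklore] -/
theorem apply_eq_inner_of_mem_frontier_of_inter_ball_eq {Ω : Opens E'} {x : E'} {r : ℝ}
    {u : E'} {γ : E' → ℝ} (hγ : Continuous γ)
    (hΩ : (Ω : Set E') ∩ Metric.ball x r =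
      {y | y ∈ Metric.ball x r ∧ γ (y - ⟪y, u⟫_ℝ • u) < ⟪y, u⟫_ℝ})
    {y : E'} (hy : y ∈ frontier (Ω : Set E')) (hyr : y ∈ Metric.ball x r) :
    γ (y - ⟪y, u⟫_ℝ • u) = ⟪y, u⟫_ℝ := by
  have hyΩ : y ∉ (Ω : Set E') := fun h => by
    simpa [Ω.isOpen.inter_frontier_eq] using Set.mem_inter h hy
  rcases lt_trichotomy (γ (y - ⟪y, u⟫_ℝ • u)) ⟪y, u⟫_ℝ with hlt | heq | hgt
  · exact absurd (hΩ ▸ ⟨hyr, hlt⟩ : y ∈ (Ω : Set E') ∩ Metric.ball x r).1 hyΩ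
  · exact heq
  · exfalso
    have hc : Continuous fun z : E' => γ (z - ⟪z, u⟫_ℝ • u) - ⟪z, u⟫_ℝ :=
      (hγ.comp (continuous_id.sub ((continuous_id.inner continuous_const).smul
        continuous_const))).sub (continuous_id.inner continuous_const)
    have hV : IsOpen ({z : E' | 0 < γ (z - ⟪z, u⟫_ℝ • u) - ⟪z, u⟫_ℝ} ∩ Metric.ball x r) :=
      (isOpen_lt continuous_const hc).inter Metric.isOpen_ball
    obtain ⟨z, ⟨hzV, hzr⟩, hzΩ⟩ :=
      mem_closure_iff.1 (frontier_subset_closure hy) _ hV ⟨sub_pos.2 hgt, hyr⟩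
    have hz : z ∈ (Ω : Set E') ∩ Metric.ball x r := ⟨hzΩ, hzr⟩
    rw [hΩ] at hz
    exact lt_asymm hz.2 (sub_pos.1 hzV)

/-- **Local finiteness of the surface measure.** If `Ω` is a Lipschitz graph inside `B(x, r)`,
then `μH[n-1] (∂Ω ∩ B(x, r)) < ∞`, `n = finrank ℝ E'`: by
`apply_eq_inner_of_mem_frontier_of_inter_ball_eq`, `∂Ω ∩ B(x, r)` lies on the graph of `γ` over
the hyperplane `uᗮ`, of dimension `n - 1` and hence `≃L ℝ^{n-1}`
(`ContinuousLinearEquiv.ofFinrankEq`), so it is contained in the image of a compact subset of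
`ℝ^{n-1}` under the Lipschitz parametrisation `v ↦ L v + γ (L v) • u`; Lipschitz maps increase
`μH[n-1]` by at most the factor `Lip^{n-1}` and `μH[n-1] = volume` on `ℝ^{n-1}` is finite on
compact sets (Evans–Gariepy, *Measure theory and fine properties of functions*, §2.4.1 Theorem 1
and §2.2 Theorem 2; revised ed. Theorems 2.8(i) and 2.5). [cite: EvansGariepy1992, §2.4.1 Theorem 1 and §2.2 Theorem 2] -/
theorem IsLipschitzGraphNear.hausdorffMeasure_frontier_inter_ball_lt_top {Ω : Opens E'}
    {x : E'} {r : ℝ} (h : IsLipschitzGraphNear Ω x r) :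
    μH[((Module.finrank ℝ E' - 1 : ℕ) : ℝ)] (frontier (Ω : Set E') ∩ Metric.ball x r) < ⊤ := by
  obtain ⟨u, hu, γ, K, hγ, hΩ⟩ := h
  set m : ℕ := Module.finrank ℝ E' - 1 with hm
  have hu0 : u ≠ 0 := by
    rintro rfl
    simp at hu
  -- the hyperplane `W = uᗮ` has dimension `m = n - 1`, hence is `≃L` to `ℝ^m`
  have hWrank : Module.finrank ℝ (ℝ ∙ u)ᗮ = Module.finrank ℝ (Fin m → ℝ) := by
    rw [Module.finrank_fintype_fun_eq_card, Fintype.card_fin]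
    have h1 := Submodule.finrank_add_finrank_orthogonal (ℝ ∙ u)
    rw [finrank_span_singleton hu0] at h1
    omega
  set W : Submodule ℝ E' := (ℝ ∙ u)ᗮ with hW
  set e : W ≃L[ℝ] (Fin m → ℝ) := ContinuousLinearEquiv.ofFinrankEq hWrank
  -- the Lipschitz parametrisation `v ↦ L v + γ (L v) • u` of the graph of `γ` over `W`
  set L : (Fin m → ℝ) →L[ℝ] E' := W.subtypeL.comp (e.symm : (Fin m → ℝ) →L[ℝ] W) with hL
  have hΨ : LipschitzWith (‖L‖₊ + ‖ContinuousLinearMap.toSpanSingleton ℝ u‖₊ * (K * ‖L‖₊))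
      fun v => L v + γ (L v) • u :=
    L.lipschitz.add
      ((ContinuousLinearMap.toSpanSingleton ℝ u).lipschitz.comp (hγ.comp L.lipschitz))
  -- `y ↦ y - ⟪y, u⟫ u` maps continuously into `W`; the compact parameter set `S`
  have hmem : ∀ y : E', y - ⟪y, u⟫_ℝ • u ∈ W := fun y => by
    rw [hW, Submodule.mem_orthogonal_singleton_iff_inner_left, inner_sub_left,
      real_inner_smul_left, real_inner_self_eq_norm_sq, hu]
    ring
  have hQc : Continuous fun y : E' => (⟨y - ⟪y, u⟫_ℝ • u, hmem y⟩ : W) :=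
    (continuous_id.sub ((continuous_id.inner continuous_const).smul continuous_const)).subtype_mk
      _
  set S : Set (Fin m → ℝ) :=
    (fun y : E' => e ⟨y - ⟪y, u⟫_ℝ • u, hmem y⟩) '' Metric.closedBall x r
  have hSc : IsCompact S := (isCompact_closedBall x r).image (e.continuous.comp hQc)
  -- the boundary piece lies in the image of `S`
  have hsub : frontier (Ω : Set E') ∩ Metric.ball x r ⊆ (fun v => L v + γ (L v) • u) '' S := by
    rintro y ⟨hy, hyr⟩
    refine ⟨e ⟨y - ⟪y, u⟫_ℝ • u, hmem y⟩, ⟨y, Metric.ball_subset_closedBall hyr, rfl⟩, ?_⟩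
    have hLy : L (e ⟨y - ⟪y, u⟫_ℝ • u, hmem y⟩) = y - ⟪y, u⟫_ℝ • u := by
      simp [hL]
    simp only [hLy, apply_eq_inner_of_mem_frontier_of_inter_ball_eq hγ.continuous hΩ hy hyr,
      sub_add_cancel]
  -- `μH[m] = volume` on `ℝ^m` is finite on the compact set `S`
  have hvol : (μH[(m : ℝ)] : Measure (Fin m → ℝ)) = volume := by
    have := hausdorffMeasure_pi_real (ι := Fin m)
    rwa [Fintype.card_fin] at this
  calc μH[(m : ℝ)] (frontier (Ω : Set E') ∩ Metric.ball x r)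
      ≤ μH[(m : ℝ)] ((fun v => L v + γ (L v) • u) '' S) := measure_mono hsub
    _ ≤ _ := hΨ.hausdorffMeasure_image_le (Nat.cast_nonneg m) S
    _ < ⊤ := by
      rw [ENNReal.rpow_natCast, hvol]
      exact ENNReal.mul_lt_top (ENNReal.pow_lt_top ENNReal.coe_lt_top) hSc.measure_lt_top

/-- **Discharge** of `isFiniteMeasure_surfaceMeasure`: the boundary of a bounded Lipschitz domain
has finite `(n-1)`-dimensional Hausdorff measure. `∂Ω` is compact (closed and bounded in the
finite-dimensional space `E'`), so by `IsCompact.measure_lt_top_of_nhdsWithin` it suffices that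
every boundary point has a ball with `μH[n-1] (∂Ω ∩ B(x, r)) < ∞`, which is
`IsLipschitzGraphNear.hausdorffMeasure_frontier_inter_ball_lt_top` for the Lipschitz graph ball
provided by `IsLipschitzDomain Ω` (Evans–Gariepy, *Measure theory and fine properties of
functions*, §2.4.1 Theorem 1 (`𝓗^s(f(A)) ≤ Lip(f)^s 𝓗^s(A)`), §2.2 Theorem 2 (`𝓗^n = 𝓛^n`),
§3.3.4 B (surface area of a Lipschitz graph), §4.2 (Lipschitz boundaries); revised ed.
Theorems 2.8(i), 2.5 and Definition 4.4). [cite: EvansGariepy1992, §2.4.1 Theorem 1, §2.2 Theorem 2 and §3.3.4] -/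
theorem isFiniteMeasure_surfaceMeasure_holds : (isFiniteMeasure_surfaceMeasure (E' := E')) := by
  intro Ω hΩ hb
  refine ⟨?_⟩
  rw [surfaceMeasure_def, Measure.restrict_apply_univ]
  have hc : IsCompact (frontier (Ω : Set E')) :=
    Metric.isCompact_of_isClosed_isBounded isClosed_frontier
      (hb.closure.subset frontier_subset_closure)
  refine hc.measure_lt_top_of_nhdsWithin fun x hx => ?_
  obtain ⟨r, hr, h⟩ := hΩ x hx
  exact ⟨_, inter_mem_nhdsWithin _ (Metric.ball_mem_nhds x hr),
    h.hausdorffMeasure_frontier_inter_ball_lt_top⟩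

end Literature.Analysis.FunctionSpaces
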